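import Summits.AtomisticToContinuum.Crystallization.Theorems.BrittleRungDescentMieRungReduction
import Literature.MathematicalPhysics.StatisticalMechanics.BarlowCoordination

/-!
# Route `BrittleRungDescent`, item `MieRung` (stmt-AtomisticToContinuum-10946), VIII: the
# coordination census of Mie ground states — energy bounds

Support file for the milestone `MieRung` (`∃ q₀, ∀ q ≥ q₀, HasPeriodicGroundStateEnergy
(miePotential q) 3 ∧ IsCrystallizing (miePotential q) 3`, crystallization on the Mie `(2q, q)`
ladder `V_q(r) = r^{-2q}/(2q) − r^{-q}/q`).  With part VII (`…MieRungSoftCap`, the soft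
coordination cap `≤ 12` from the kissing number) and part IX (`…MieRungCensus`, the assembly) it
proves the first unconditional structural statement about the ground states of `V_q` in `ℝ³`:
asymptotically in `q`, all but a fraction `δ` of the particles of every large ground state have
EXACTLY twelve neighbours within `1 + η` — the bond-counting half ("`MieBondCount`") of the
route's crux `MieSoftKissing` (item stmt-AtomisticToContinuum-10943), whose remaining content is
the `o(N)` upgrade at FIXED `q` and the annulus `(1 + η, 1.26)`.

This part VIII supplies the two energy bounds, against the generic-`V` series of parts I–VI
(`MieRungEnergetic`, thermodynamic limit `E_V(N)/N → ⨅_Q e_V(Q)` and its trial-state half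
`eventually_groundStateEnergy_div_le`):

* `fccUnit`, `energyPerParticle_fccUnit_le` — **the fcc trial state**: the face-centred cubic
  configuration at nearest-neighbour distance `1` (the tree's `fccPeriodicConfiguration`,
  `a = 1`, `h = √(2/3)`) has `e_{V_q}(fcc) ≤ −3/q` for `q ≥ 6` (twelve neighbours in the well,
  `ncard_touching_eq_twelve`; all other points at distance `≥ 1`,
  `le_dist_of_mem_barlowStacking_ideal`, where `V_q ≤ 0`);
* `siteEnergy_ge_nearCount`, `two_mul_interactionEnergy_ge_sum_nearCount` — **site energy
  versus soft coordination**: in an `r`-separated configuration,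
  `𝓔ⁱ ≥ −n_i(η)/(2q) − (250 r⁻⁶/q)(1+η)^{-(q−6)}` (`n_i(η)` = number of other particles within
  `1 + η`; well depth `−1/(2q)` for the near ones, the tail `V_q ≥ −r^{-q}/q` and the shell sum
  `Σ d⁻⁶ ≤ 250 r⁻⁶` of `LennardJonesClusters` for the far ones), summed to
  `2𝓔 ≥ −(Σ n_i)/(2q) − N·(250 r⁻⁶/q)(1+η)^{-(q−6)}`;
* `card_ne_twelve_le` — the counting step: `n_i ≤ 12` for all `i` and `Σ n_i ≥ 12N − B` give
  `#{i : n_i ≠ 12} ≤ B`.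

All `[folklore]` (Blanc–Lewin 2015, §1.3, §2.2; Hales, *Dense Sphere Packings* §1.3 for fcc).
-/

noncomputable section

open scoped BigOperators Topology
open Filter Set Metric

namespace Summit.AtomisticToContinuum.Crystallization.Theorems.MieRungCoordination

open Literature.MathematicalPhysics.StatisticalMechanics
open Summit.AtomisticToContinuum.Crystallization.Theorems.MieRungEnergetic

/-! ### The fcc trial state -/

/-- `√(2/3) ≠ 0`. [folklore] -/
theorem sqrt_two_thirds_ne_zero : Real.sqrt (2 / 3) ≠ 0 :=
  (Real.sqrt_pos.2 (by norm_num)).ne'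

/-- The motif of the unit fcc configuration (the tree's `fccPeriodicConfiguration` at in-layer
spacing `a = 1` and ideal layer spacing `h = √(2/3)`, nearest-neighbour distance `1`) is the
single point `barlowPos 1 √(2/3) constHagg 0 0 0`. [folklore] -/
theorem fccUnit_motif :
    (fccPeriodicConfiguration (a := 1) (h := Real.sqrt (2 / 3)) one_ne_zero
        sqrt_two_thirds_ne_zero).motif =
      {barlowPos 1 (Real.sqrt (2 / 3)) constHagg ((0 : ℕ) : ℤ) 0 0} := by
  simp [fccPeriodicConfiguration, barlowPeriodicConfiguration]

/-- Its point set is the fcc stacking `barlowStacking 1 √(2/3) constHagg`. [folklore] -/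
theorem fccUnit_points :
    (fccPeriodicConfiguration (a := 1) (h := Real.sqrt (2 / 3)) one_ne_zero
        sqrt_two_thirds_ne_zero).points =
      barlowStacking 1 (Real.sqrt (2 / 3)) constHagg := by
  rw [fccPeriodicConfiguration_points]; rfl

/-- **The fcc trial energy on the ladder**: for `q ≥ 6`, the energy per particle of the unit fcc
configuration under `V_q` is at most `−3/q` (twelve nearest neighbours at the well, `V_q(1) =
−1/(2q)`, all other lattice points at distance `≥ 1` where `V_q ≤ 0`). [folklore] -/
theorem energyPerParticle_fccUnit_le {q : ℕ} (hq : 6 ≤ q) :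
    (fccPeriodicConfiguration (a := 1) (h := Real.sqrt (2 / 3)) one_ne_zero
        sqrt_two_thirds_ne_zero).energyPerParticle (miePotential q) ≤ -(3 / (q : ℝ)) := by
  classical
  set fccUnit := fccPeriodicConfiguration (a := 1) (h := Real.sqrt (2 / 3)) one_ne_zero
    sqrt_two_thirds_ne_zero with hfccUnit
  have hq0 : q ≠ 0 := by omega
  set h : ℝ := Real.sqrt (2 / 3) with hh_def
  have hh : h ^ 2 = 2 / 3 * (1 : ℝ) ^ 2 := by rw [hh_def, Real.sq_sqrt (by norm_num)]; ring
  set x₀ : EuclideanSpace ℝ (Fin 3) := barlowPos 1 h constHagg ((0 : ℕ) : ℤ) 0 0 with hx₀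
  have hx₀mem : x₀ ∈ barlowStacking 1 h constHagg := barlowPos_mem _ _ _
  -- the twelve touching points, as a finset of the index subtype of the lattice sum at `x₀`
  set T : Set (EuclideanSpace ℝ (Fin 3)) := {w | w ∈ barlowStacking 1 h constHagg ∧ dist x₀ w = 1}
    with hT
  have hT12 : T.ncard = 12 := ncard_touching_eq_twelve isHaggSeq_const one_pos hh hx₀mem
  have hTfin : T.Finite := Set.finite_of_ncard_ne_zero (by rw [hT12]; norm_num)
  set S := {y : EuclideanSpace ℝ (Fin 3) // y ∈ fccUnit.points ∧ y ≠ x₀} with hS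
  have hmemS : ∀ w ∈ T, w ∈ fccUnit.points ∧ w ≠ x₀ := by
    intro w hw
    refine ⟨by rw [fccUnit_points]; exact hw.1, fun h0 => ?_⟩
    have := hw.2
    rw [h0, dist_self] at this
    exact zero_ne_one this
  set s₀ : Finset S := hTfin.toFinset.subtype fun y => y ∈ fccUnit.points ∧ y ≠ x₀ with hs₀
  have hs₀card : s₀.card = 12 := by
    rw [hs₀, Finset.card_subtype, Finset.filter_true_of_mem (fun w hw => hmemS w
      (hTfin.mem_toFinset.1 hw)), ← Set.ncard_eq_toFinset_card T hTfin, hT12]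
  have hs₀dist : ∀ y ∈ s₀, dist x₀ y.1 = 1 := by
    intro y hy
    rw [hs₀, Finset.mem_subtype] at hy
    exact ((hTfin.mem_toFinset).1 hy).2
  -- the lattice sum at `x₀` is at most the sum over the twelve touching points
  set f : S → ℝ := fun y => miePotential q (dist x₀ y.1) with hf
  have hsum : Summable f :=
    summable_dist (V := miePotential q) (A := 1 / 6)
      (fun r hr => LadderGroundStates.miePotential_nonpos hq0 hr)
      (fun r hr => neg_six_le_miePotential hq hr) (by norm_num) fccUnit x₀
  have hsign : ∀ y ∉ s₀, 0 ≤ (fun b => -f b) y := by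
    intro y _
    have hy1 : (1 : ℝ) ≤ dist x₀ y.1 := by
      have hpts : ∀ z : EuclideanSpace ℝ (Fin 3), z ∈ fccUnit.points →
          z ∈ barlowStacking 1 h constHagg := fun z hz => by rwa [fccUnit_points] at hz
      have hyS : y.1 ∈ barlowStacking 1 h constHagg := hpts _ y.2.1
      exact le_dist_of_mem_barlowStacking_ideal isHaggSeq_const one_pos hh hx₀mem hyS
        (Ne.symm y.2.2)
    simp only [hf, neg_nonneg]
    exact LadderGroundStates.miePotential_nonpos hq0 hy1
  have h1 := sum_le_hasSum s₀ hsign hsum.hasSum.neg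
  rw [Finset.sum_neg_distrib] at h1
  have htsum : (∑' y : S, f y) ≤ ∑ y ∈ s₀, f y := by linarith
  have hs₀sum : ∑ y ∈ s₀, f y = 12 * (-1 / (2 * (q : ℝ))) := by
    have hterm : ∀ y ∈ s₀, f y = -1 / (2 * (q : ℝ)) := fun y hy => by
      simp only [hf]
      rw [hs₀dist y hy, miePotential_one hq0]
    rw [Finset.sum_congr rfl hterm, Finset.sum_const, hs₀card, nsmul_eq_mul]
    norm_num
  -- assemble
  unfold PeriodicConfiguration.energyPerParticle
  rw [fccUnit_motif, Finset.card_singleton, Finset.sum_singleton]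
  have hq' : (0 : ℝ) < q := by exact_mod_cast Nat.pos_of_ne_zero hq0
  have key : (∑' y : S, f y) ≤ -(6 / (q : ℝ)) := by
    rw [hs₀sum] at htsum
    have : 12 * (-1 / (2 * (q : ℝ))) = -(6 / (q : ℝ)) := by field_simp; ring
    linarith
  have hcast : ((1 : ℕ) : ℝ) = 1 := by norm_num
  rw [hcast]
  calc (2 * (1 : ℝ))⁻¹ * ∑' y : S, f y ≤ (2 * (1 : ℝ))⁻¹ * (-(6 / (q : ℝ))) :=
        mul_le_mul_of_nonneg_left key (by norm_num)
    _ = -(3 / (q : ℝ)) := by ring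

/-! ### Site energy versus soft coordination -/

variable {N : ℕ}

/-- The **soft coordination number** `n_i(η) = #{j ≠ i : |xᵢ − xⱼ| ≤ 1 + η}` of particle `i` at
tolerance `η` (written, as in the route's statements, as the cardinality of a subtype of
`Fin N`) is the cardinality of the corresponding filter of `univ.erase i`. [folklore] -/
theorem natCard_near_eq_card_filter (x : Fin N → EuclideanSpace ℝ (Fin 3)) (η : ℝ)
    (i : Fin N) [DecidablePred fun k : Fin N => dist (x i) (x k) ≤ 1 + η] :
    Nat.card {j : Fin N // j ≠ i ∧ dist (x i) (x j) ≤ 1 + η} =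
      ((Finset.univ.erase i).filter fun k => dist (x i) (x k) ≤ 1 + η).card := by
  classical
  rw [Nat.card_eq_fintype_card, Fintype.card_subtype]
  congr 1
  ext j
  simp [Finset.mem_filter, Finset.mem_erase]

/-- The soft coordination number is monotone in the tolerance. [folklore] -/
theorem natCard_near_mono (x : Fin N → EuclideanSpace ℝ (Fin 3)) {η η' : ℝ} (h : η ≤ η')
    (i : Fin N) :
    Nat.card {j : Fin N // j ≠ i ∧ dist (x i) (x j) ≤ 1 + η} ≤
      Nat.card {j : Fin N // j ≠ i ∧ dist (x i) (x j) ≤ 1 + η'} := by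
  classical
  rw [natCard_near_eq_card_filter, natCard_near_eq_card_filter]
  refine Finset.card_le_card fun k hk => ?_
  rw [Finset.mem_filter] at hk ⊢
  exact ⟨hk.1, hk.2.trans (by linarith)⟩

/-- **The attractive tail of `V_q`**: `V_q(r) ≥ −r^{-q}/q` for all `r`. [folklore] -/
theorem neg_inv_pow_le_miePotential (q : ℕ) (r : ℝ) :
    -(1 / (q : ℝ) * r⁻¹ ^ q) ≤ miePotential q r := by
  rw [miePotential_apply]
  have h2 : 0 ≤ r⁻¹ ^ (2 * q) := by rw [pow_mul]; positivity
  have : 0 ≤ 1 / (2 * (q : ℝ)) * r⁻¹ ^ (2 * q) := by positivity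
  linarith

/-- Beyond `1 + η` the inverse `q`-th power is dominated by the inverse sixth power with the
geometric factor `(1 + η)^{-(q-6)}`: `r^{-q} ≤ (1+η)^{-(q-6)} r⁻⁶` for `r ≥ 1 + η > 0`, `q ≥ 6`.
[folklore] -/
theorem inv_pow_le_geom_mul_inv_pow_six {q : ℕ} (hq : 6 ≤ q) {η r : ℝ} (hη : 0 < 1 + η)
    (hr : 1 + η ≤ r) : r⁻¹ ^ q ≤ (1 + η)⁻¹ ^ (q - 6) * r⁻¹ ^ 6 := by
  have hr0 : 0 < r := hη.trans_le hr
  have hinv : r⁻¹ ≤ (1 + η)⁻¹ := (inv_le_inv₀ hr0 hη).2 hr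
  have hinv0 : 0 ≤ r⁻¹ := inv_nonneg.2 hr0.le
  calc r⁻¹ ^ q = r⁻¹ ^ (q - 6) * r⁻¹ ^ 6 := by rw [← pow_add, Nat.sub_add_cancel hq]
    _ ≤ (1 + η)⁻¹ ^ (q - 6) * r⁻¹ ^ 6 :=
        mul_le_mul_of_nonneg_right (pow_le_pow_left₀ hinv0 hinv _) (by positivity)

/-- **Site energy versus soft coordination.** For `q ≥ 6`, an `r`-separated configuration
(`r > 0`) and a tolerance `η > -1`: the site energy of particle `i` under `V_q` is at least
`−n_i(η)/(2q) − (250 r⁻⁶/q)(1+η)^{-(q-6)}`, where `n_i(η)` is its soft coordination number —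
each of the `n_i` near particles contributes at least the well depth `−1/(2q)`, and the far ones
at least `−(1/q) Σ_{d > 1+η} d^{-q} ≥ −(1/q)(1+η)^{-(q-6)} Σ d⁻⁶` with the shell sum
`Σ d⁻⁶ ≤ 250 r⁻⁶`.
[folklore] -/
theorem siteEnergy_ge_nearCount {q : ℕ} (hq : 6 ≤ q) {x : Fin N → EuclideanSpace ℝ (Fin 3)}
    {r : ℝ} (hr : 0 < r) (hsep : ∀ k l, k ≠ l → r ≤ dist (x k) (x l)) {η : ℝ} (hη : 0 < 1 + η)
    (i : Fin N) :
    -((Nat.card {j : Fin N // j ≠ i ∧ dist (x i) (x j) ≤ 1 + η} : ℝ) / (2 * (q : ℝ))) -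
        250 * r⁻¹ ^ 6 / (q : ℝ) * (1 + η)⁻¹ ^ (q - 6) ≤ siteEnergy (miePotential q) x i := by
  classical
  have hq0 : q ≠ 0 := by omega
  have hqpos : (0 : ℝ) < q := by exact_mod_cast Nat.pos_of_ne_zero hq0
  set s := Finset.univ.erase i with hs
  set near := s.filter fun k => dist (x i) (x k) ≤ 1 + η with hnear
  set far := s.filter fun k => ¬ dist (x i) (x k) ≤ 1 + η with hfar
  have hsplit : siteEnergy (miePotential q) x i =
      ∑ k ∈ near, miePotential q (dist (x i) (x k)) +
        ∑ k ∈ far, miePotential q (dist (x i) (x k)) := by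
    rw [siteEnergy, ← Finset.sum_filter_add_sum_filter_not s fun k => dist (x i) (x k) ≤ 1 + η]
  -- near part
  have hnear_ge :
      -((Nat.card {j : Fin N // j ≠ i ∧ dist (x i) (x j) ≤ 1 + η} : ℝ) / (2 * (q : ℝ))) ≤
      ∑ k ∈ near, miePotential q (dist (x i) (x k)) := by
    have h1 : ∑ k ∈ near, (-1 / (2 * (q : ℝ))) ≤
        ∑ k ∈ near, miePotential q (dist (x i) (x k)) :=
      Finset.sum_le_sum fun k _ => neg_one_div_le_miePotential hq0 _
    rw [Finset.sum_const, nsmul_eq_mul] at h1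
    have h2 : (near.card : ℝ) = Nat.card {j : Fin N // j ≠ i ∧ dist (x i) (x j) ≤ 1 + η} := by
      rw [natCard_near_eq_card_filter]
    rw [h2] at h1
    have h3 : (Nat.card {j : Fin N // j ≠ i ∧ dist (x i) (x j) ≤ 1 + η} : ℝ) *
        (-1 / (2 * (q : ℝ))) =
        -((Nat.card {j : Fin N // j ≠ i ∧ dist (x i) (x j) ≤ 1 + η} : ℝ) / (2 * (q : ℝ))) := by
      ring
    linarith
  -- far part
  have hfar_ge : -(250 * r⁻¹ ^ 6 / (q : ℝ) * (1 + η)⁻¹ ^ (q - 6)) ≤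
      ∑ k ∈ far, miePotential q (dist (x i) (x k)) := by
    have h1 : ∑ k ∈ far, -(1 / (q : ℝ) * ((1 + η)⁻¹ ^ (q - 6) * (dist (x i) (x k))⁻¹ ^ 6)) ≤
        ∑ k ∈ far, miePotential q (dist (x i) (x k)) := by
      refine Finset.sum_le_sum fun k hk => ?_
      have hk' : 1 + η ≤ dist (x i) (x k) := by
        have := (Finset.mem_filter.1 hk).2
        exact le_of_lt (not_le.1 this)
      have h2 := inv_pow_le_geom_mul_inv_pow_six hq hη hk'
      have h3 := neg_inv_pow_le_miePotential q (dist (x i) (x k))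
      have h4 : 1 / (q : ℝ) * (dist (x i) (x k))⁻¹ ^ q ≤
          1 / (q : ℝ) * ((1 + η)⁻¹ ^ (q - 6) * (dist (x i) (x k))⁻¹ ^ 6) :=
        mul_le_mul_of_nonneg_left h2 (by positivity)
      linarith
    have h5 : ∑ k ∈ far, (dist (x i) (x k))⁻¹ ^ 6 ≤ 250 * r⁻¹ ^ 6 := by
      calc ∑ k ∈ far, (dist (x i) (x k))⁻¹ ^ 6 ≤ ∑ k ∈ s, (dist (x i) (x k))⁻¹ ^ 6 :=
            Finset.sum_le_sum_of_subset_of_nonneg (Finset.filter_subset _ _)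
              fun k _ _ => by positivity
        _ ≤ 250 * r⁻¹ ^ 6 := sum_inv_pow_six_le x hr hsep i
    have h6 : ∑ k ∈ far, -(1 / (q : ℝ) * ((1 + η)⁻¹ ^ (q - 6) * (dist (x i) (x k))⁻¹ ^ 6)) =
        -(1 / (q : ℝ) * (1 + η)⁻¹ ^ (q - 6)) * ∑ k ∈ far, (dist (x i) (x k))⁻¹ ^ 6 := by
      rw [Finset.mul_sum]
      exact Finset.sum_congr rfl fun k _ => by ring
    rw [h6] at h1
    have hc : 0 ≤ 1 / (q : ℝ) * (1 + η)⁻¹ ^ (q - 6) := by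
      have : 0 ≤ (1 + η)⁻¹ := inv_nonneg.2 hη.le
      positivity
    have h7 : -(1 / (q : ℝ) * (1 + η)⁻¹ ^ (q - 6)) * ∑ k ∈ far, (dist (x i) (x k))⁻¹ ^ 6 ≥
        -(1 / (q : ℝ) * (1 + η)⁻¹ ^ (q - 6)) * (250 * r⁻¹ ^ 6) := by
      have := mul_le_mul_of_nonneg_left h5 hc
      linarith
    have h8 : -(1 / (q : ℝ) * (1 + η)⁻¹ ^ (q - 6)) * (250 * r⁻¹ ^ 6) =
        -(250 * r⁻¹ ^ 6 / (q : ℝ) * (1 + η)⁻¹ ^ (q - 6)) := by ring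
    linarith
  rw [hsplit]
  linarith

/-- **Summed over the configuration**:
`2 𝓔_{V_q}(x) ≥ −(Σ_i n_i(η))/(2q) − N · (250 r⁻⁶/q)(1+η)^{-(q-6)}`.
[folklore] -/
theorem two_mul_interactionEnergy_ge_sum_nearCount {q : ℕ} (hq : 6 ≤ q)
    {x : Fin N → EuclideanSpace ℝ (Fin 3)} {r : ℝ} (hr : 0 < r)
    (hsep : ∀ k l, k ≠ l → r ≤ dist (x k) (x l)) {η : ℝ} (hη : 0 < 1 + η) :
    -((∑ i, (Nat.card {j : Fin N // j ≠ i ∧ dist (x i) (x j) ≤ 1 + η} : ℝ)) / (2 * (q : ℝ))) -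
        (N : ℝ) * (250 * r⁻¹ ^ 6 / (q : ℝ) * (1 + η)⁻¹ ^ (q - 6)) ≤
      2 * interactionEnergy (miePotential q) x := by
  rw [two_mul_interactionEnergy]
  have h := Finset.sum_le_sum fun i (_ : i ∈ Finset.univ) =>
    siteEnergy_ge_nearCount hq hr hsep hη i (x := x)
  have hL : ∑ i,
      (-((Nat.card {j : Fin N // j ≠ i ∧ dist (x i) (x j) ≤ 1 + η} : ℝ) / (2 * (q : ℝ))) -
      250 * r⁻¹ ^ 6 / (q : ℝ) * (1 + η)⁻¹ ^ (q - 6)) =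
      -((∑ i, (Nat.card {j : Fin N // j ≠ i ∧ dist (x i) (x j) ≤ 1 + η} : ℝ)) / (2 * (q : ℝ))) -
        (N : ℝ) * (250 * r⁻¹ ^ 6 / (q : ℝ) * (1 + η)⁻¹ ^ (q - 6)) := by
    rw [Finset.sum_sub_distrib, Finset.sum_neg_distrib, Finset.sum_div, Finset.sum_const,
      Finset.card_univ, Fintype.card_fin, nsmul_eq_mul]
  rw [hL] at h
  exact h

/-- **Counting the under-coordinated particles.** If every soft coordination number is `≤ 12`
and their sum is at least `12 N − B`, then at most `B` particles have soft coordination number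
`≠ 12`. [folklore] -/
theorem card_ne_twelve_le {n : Fin N → ℕ} (hle : ∀ i, n i ≤ 12) {B : ℝ}
    (hsum : 12 * (N : ℝ) - B ≤ ∑ i, (n i : ℝ)) :
    ((Finset.univ.filter fun i => n i ≠ 12).card : ℝ) ≤ B := by
  classical
  -- `Σ_i (12 − n_i) ≥ #{n_i ≠ 12}` since each such term is `≥ 1`
  have h1 : ((Finset.univ.filter fun i => n i ≠ 12).card : ℝ) ≤ ∑ i, ((12 : ℝ) - n i) := by
    rw [← Finset.sum_filter_add_sum_filter_not Finset.univ fun i => n i ≠ 12]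
    have ha : ((Finset.univ.filter fun i => n i ≠ 12).card : ℝ) ≤
        ∑ i ∈ Finset.univ.filter (fun i => n i ≠ 12), ((12 : ℝ) - n i) := by
      have : ∑ i ∈ Finset.univ.filter (fun i => n i ≠ 12), (1 : ℝ) ≤
          ∑ i ∈ Finset.univ.filter (fun i => n i ≠ 12), ((12 : ℝ) - n i) := by
        refine Finset.sum_le_sum fun i hi => ?_
        have hne : n i ≠ 12 := (Finset.mem_filter.1 hi).2
        have hlt : n i ≤ 11 := by have := hle i; omega
        have : (n i : ℝ) ≤ 11 := by exact_mod_cast hlt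
        linarith
      simpa using this
    have hb : 0 ≤ ∑ i ∈ Finset.univ.filter (fun i => ¬ n i ≠ 12), ((12 : ℝ) - n i) :=
      Finset.sum_nonneg fun i _ => by
        have : (n i : ℝ) ≤ 12 := by exact_mod_cast hle i
        linarith
    linarith
  have h2 : ∑ i, ((12 : ℝ) - n i) = 12 * (N : ℝ) - ∑ i, (n i : ℝ) := by
    rw [Finset.sum_sub_distrib, Finset.sum_const, Finset.card_univ, Fintype.card_fin,
      nsmul_eq_mul, mul_comm]
  linarith

end Summit.AtomisticToContinuum.Crystallization.Theorems.MieRungCoordination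

end
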